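import Mathlib
import Literature.MathematicalPhysics.QuantumFieldTheory.Balaban1983to89.B14

/-!
# `Balaban1983to89.B15Claim179` — [Balaban1989LargeFieldI] p. 179: the integer `N₀` defined by
# `L^{−N₀+1}MR_{k−N₀+1} = M` — «either there is exactly one such integer, or there are two» (typed; the «at most
# two, consecutive» half PROVED from (2.9) [III], existence PROVED under monotone unit steps of the sizes `R_j`)

statement-level skeleton of published theorems with citation tags; proofs where landed; nothing here is a claim about
the Yang–Mills mass gap.

CITATION HEADER (lean-in-tree rule 2026-08-18).  T. Bałaban, *Large field renormalization. I. The basic step of the 𝐑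
operation*, Commun. Math. Phys. **122**, 175–202 (1989), doi:10.1007/BF01257412, bib `Balaban1989LargeFieldI` (cell
paper B15; PDF held `paper:balaban1989-cmp122-large-field-i`, journal page = PDF page + 174; the sentences below were
READ AS AN IMAGE on the x2 render `…/1989-cmp122-large-field-I/1989-cmp122-large-field-I-p005-x2.png`, p. 179).
[III] = [Balaban1988Convergent] (cell paper B14): (2.5) p. 255 = `B14.IsRj` (*"R_j is the smallest number of the form
L^r such, that R_j ≥ (log g_j⁻²)^r"* — so every `R_j` is a power of `L`), (2.9) p. 256 = `B14FlowStep.FlowIneq29` /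
`third_members` (*"R_m ≤ … ≤ (L+1)(n−m)^{β₀}R_n"*).  WHAT IS REPRODUCED: SKELETON row `B15.Claim@179`, unit
`lit-balaban-r12` gen 3 (reader/typer of block B15), HOME `run/shared/lean/pub/lit-balaban/`
(`lit-balaban-r12/ROWS-B15.md`).

THE PRINTED TEXT (p. 179, verbatim): *"Let us recall that the domains Ω_j^{∼n} are unions of L^{−(k−j)}MR_j-cubes of
the lattice T_η. Take the smallest positive integer N₀ such, that L^{−N₀+1}MR_{k−N₀+1} = M. It is easy to see that
either there is exactly one such integer, or there are two. We assume that N > N₀, in fact it will become clear later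
that N is much greater than N₀."*  (Also p. 192: *"L^{−N₀+1}R_{k−N₀+1} = 1, or L^{N₀−1} = R_{k−N₀+1}"*.)

WHAT IS TYPED AND PROVED.  With the sizes written as powers `R_j = L^{s_j}` ((2.5)), the equation reads
`s_{k−N+1} = N − 1` (`eq179_iff`, also the real form with `M ≠ 0` cancelled: `eq179_real_iff`); `sols L s k` = the
positive integers `N ≤ k` solving it; `IsN0` = *"the smallest positive integer N₀ such that …"*; `Claim179` = *"either
there is exactly one such integer, or there are two"* (`(sols …).card = 1 ∨ (sols …).card = 2`).  PROVED: (a) any two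
solutions differ by at most one (`sol_sub_le_one`) — hence AT MOST TWO (`card_sols_le_two`) — from the exponent form
of the third member of (2.9) [III] over gaps `≥ 2`, `s_m < s_n + (n − m)` (`GapHyp`), itself derived from the printed
real inequality `R_m ≤ (L+1)(n−m)^{β₀}R_n` once `(L+1)·2^{β₀} < L²`, `β₀ ≤ 1` (`gapHyp_of_third_member`; `β₀` is
*"arbitrarily small"*, (2.6) [III]); (b) EXISTENCE of a solution by a discrete intermediate-value argument
(`exists_sol`) under monotone unit steps `s_j ∈ {s_{j+1}, s_{j+1} + 1}` (finer scale, larger-or-equal `R`, at most one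
factor `L` per step — the picture behind *"easy to see"*; (2.9) alone allows steps of both signs) and `s_1 + 1 ≤ k`
(enough steps); (c) the printed dichotomy `claim179_of` from (a) + (b).

HONEST SCOPE.  Print asserts existence and «one or two» outright; here «at most two» is a theorem from (2.9) [III]
plus the stated smallness of `β₀`, and existence is conditional on the monotonicity hypothesis named above (not printed;
(2.6)/(2.9) of [III] bound the couplings/sizes both ways up to factors `(1+β₀)`, `L`, and do not force monotonicity).
Integer bookkeeping only; `M`, the lattices and the domains `Ω_j^{∼n}` are not modelled.  Value = a typed row with
its provable half kernel-checked; NOT summit progress.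
-/

namespace Literature.MathematicalPhysics.QuantumFieldTheory.Balaban1983to89.B15Claim179

open Finset

/-! ## The equation and its solution set -/

/-- The defining equation of `N₀` at a positive integer `N`, for sizes `R_j = L^{s_j}` (exponents `s`), verbatim
p. 179 *"L^{−N₀+1}MR_{k−N₀+1} = M"* ⇔ p. 192 *"L^{N₀−1} = R_{k−N₀+1}"*: in exponents, `s_{k−N+1} = N − 1`.
[cite: Balaban1989LargeFieldI, p.179] -/
abbrev Eq179 (s : ℕ → ℕ) (k N : ℕ) : Prop := s (k - N + 1) = N - 1

/-- The exponent form IS the printed power form `R_{k−N+1} = L^{N−1}` (`L ≥ 2`). [cite: Balaban1989LargeFieldI, p.179] -/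
theorem eq179_iff {L : ℕ} (hL : 2 ≤ L) (s : ℕ → ℕ) (k N : ℕ) :
    L ^ s (k - N + 1) = L ^ (N - 1) ↔ Eq179 s k N := by
  unfold Eq179
  constructor
  · intro h; exact Nat.pow_right_injective hL h
  · intro h; rw [h]

/-- The printed real form with the factor `M` cancelled: for `M ≠ 0`, `L^{−N+1}·M·R_{k−N+1} = M ⇔ R_{k−N+1} = L^{N−1}`
(`N ≥ 1`, `R_{k−N+1} = L^{s_{k−N+1}}`). [cite: Balaban1989LargeFieldI, p.179] -/
theorem eq179_real_iff {L : ℕ} (hL : 2 ≤ L) {M : ℝ} (hM : M ≠ 0) (s : ℕ → ℕ) (k : ℕ) {N : ℕ} (hN : 1 ≤ N) :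
    (L : ℝ) ^ (-(N : ℤ) + 1) * M * (L : ℝ) ^ s (k - N + 1) = M ↔ Eq179 s k N := by
  rw [← eq179_iff hL]
  have hL0 : (0 : ℝ) < L := by exact_mod_cast (lt_of_lt_of_le (by norm_num) hL : 0 < L)
  have hz : (L : ℝ) ^ (-(N : ℤ) + 1) = ((L : ℝ) ^ (N - 1))⁻¹ := by
    rw [← zpow_natCast, ← zpow_neg]
    congr 1
    push_cast [Nat.cast_sub hN]
    ring
  rw [hz]
  have hpow : (0 : ℝ) < (L : ℝ) ^ (N - 1) := pow_pos hL0 _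
  constructor
  · intro h
    have h' : (L : ℝ) ^ s (k - N + 1) = (L : ℝ) ^ (N - 1) := by
      field_simp at h
      linarith [h]
    exact_mod_cast h'
  · intro h
    rw [show ((L : ℝ) ^ s (k - N + 1)) = (L : ℝ) ^ (N - 1) by exact_mod_cast h]
    field_simp

/-- The positive integers `N ≤ k` solving the equation (`N ≤ k`: the scale `k − N + 1 ≥ 1` exists).
[cite: Balaban1989LargeFieldI, p.179] -/
def sols (s : ℕ → ℕ) (k : ℕ) : Finset ℕ := (Finset.Icc 1 k).filter fun N => Eq179 s k N

/-- Membership in the solution set. [cite: Balaban1989LargeFieldI, p.179] -/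
theorem mem_sols {s : ℕ → ℕ} {k N : ℕ} : N ∈ sols s k ↔ (1 ≤ N ∧ N ≤ k) ∧ Eq179 s k N := by
  simp only [sols, Finset.mem_filter, Finset.mem_Icc]


/-- *"the smallest positive integer N₀ such, that L^{−N₀+1}MR_{k−N₀+1} = M"*. [cite: Balaban1989LargeFieldI, p.179] -/
def IsN0 (s : ℕ → ℕ) (k N₀ : ℕ) : Prop := N₀ ∈ sols s k ∧ ∀ N ∈ sols s k, N₀ ≤ N

/-- **p. 179 claim**, verbatim: *"It is easy to see that either there is exactly one such integer, or there are
two."* [cite: Balaban1989LargeFieldI, p.179] -/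
def Claim179 (s : ℕ → ℕ) (k : ℕ) : Prop := (sols s k).card = 1 ∨ (sols s k).card = 2

/-! ## (a) At most two solutions, from the third member of (2.9) [III] -/

/-- The exponent form of the third member of (2.9) [III] over gaps of at least two scales: `R_m < L^{n−m}R_n`, i.e.
`s_m < s_n + (n − m)` for `1 ≤ m < n ≤ k`, `n − m ≥ 2` (derived from the printed real form in
`gapHyp_of_third_member`). [cite: Balaban1989LargeFieldI, p.179] -/
def GapHyp (s : ℕ → ℕ) (k : ℕ) : Prop :=
  ∀ m n, 1 ≤ m → m < n → n ≤ k → 2 ≤ n - m → s m < s n + (n - m)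

/-- Two solutions differ by at most one. [cite: Balaban1989LargeFieldI, p.179] -/
theorem sol_sub_le_one {s : ℕ → ℕ} {k : ℕ} (hg : GapHyp s k) {N N' : ℕ} (hN : N ∈ sols s k)
    (hN' : N' ∈ sols s k) : N' ≤ N + 1 := by
  by_contra hc
  rw [not_le] at hc
  obtain ⟨⟨h1, h2⟩, e⟩ := mem_sols.1 hN
  obtain ⟨⟨h1', h2'⟩, e'⟩ := mem_sols.1 hN'
  unfold Eq179 at e e'
  have := hg (k - N' + 1) (k - N + 1) (by omega) (by omega) (by omega) (by omega)
  omega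

/-- Hence **at most two** such integers (and they are consecutive). [cite: Balaban1989LargeFieldI, p.179] -/
theorem card_sols_le_two {s : ℕ → ℕ} {k : ℕ} (hg : GapHyp s k) : (sols s k).card ≤ 2 := by
  by_cases hne : (sols s k).Nonempty
  · set N := (sols s k).min' hne with hN
    have hNmem : N ∈ sols s k := Finset.min'_mem _ hne
    have hsub : sols s k ⊆ {N, N + 1} := by
      intro N' hN'
      have h1 : N ≤ N' := Finset.min'_le _ _ hN'
      have h2 := sol_sub_le_one hg hNmem hN'
      rw [Finset.mem_insert, Finset.mem_singleton]
      omega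
    exact (Finset.card_le_card hsub).trans (Finset.card_le_two)
  · rw [Finset.not_nonempty_iff_eq_empty] at hne
    rw [hne]; simp

/-- `(L+1)·j^{β₀} < L^j` for `j ≥ 2` once `(L+1)·2^{β₀} < L²` and `β₀ ≤ 1` (so the `(n−m)^{β₀}` of (2.9) never
makes up a full factor `L` per scale over two or more scales). [cite: Balaban1989LargeFieldI, p.179] -/
theorem succ_mul_rpow_lt_pow {L : ℕ} (hL : 2 ≤ L) {β₀ : ℝ} (hβ1 : β₀ ≤ 1)
    (hLβ : ((L : ℝ) + 1) * (2 : ℝ) ^ β₀ < (L : ℝ) ^ 2) {j : ℕ} (hj : 2 ≤ j) :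
    ((L : ℝ) + 1) * (j : ℝ) ^ β₀ < (L : ℝ) ^ j := by
  have hj2 : (1 : ℝ) ≤ (j : ℝ) / 2 := by
    rw [le_div_iff₀ (by norm_num : (0:ℝ) < 2)]; exact_mod_cast hj
  -- j^β₀ = 2^β₀ (j/2)^β₀ ≤ 2^β₀ (j/2)
  have hsplit : (j : ℝ) ^ β₀ = (2 : ℝ) ^ β₀ * ((j : ℝ) / 2) ^ β₀ := by
    rw [← Real.mul_rpow (by norm_num) (by positivity)]
    congr 1; ring
  have hhalf : ((j : ℝ) / 2) ^ β₀ ≤ (j : ℝ) / 2 := by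
    calc ((j : ℝ) / 2) ^ β₀ ≤ ((j : ℝ) / 2) ^ (1 : ℝ) := Real.rpow_le_rpow_of_exponent_le hj2 hβ1
      _ = (j : ℝ) / 2 := Real.rpow_one _
  have h2β : (0 : ℝ) < (2 : ℝ) ^ β₀ := by positivity
  -- L² (j/2) ≤ L^j
  have hL1 : (2 : ℝ) ≤ L := by exact_mod_cast hL
  have hpow : (L : ℝ) ^ 2 * ((j : ℝ) / 2) ≤ (L : ℝ) ^ j := by
    obtain ⟨i, rfl⟩ : ∃ i, j = i + 2 := ⟨j - 2, by omega⟩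
    rw [pow_add, mul_comm ((L : ℝ) ^ i)]
    refine mul_le_mul_of_nonneg_left ?_ (by positivity)
    have h2i : ((i + 2 : ℕ) : ℝ) / 2 ≤ (2 : ℝ) ^ i := by
      rw [div_le_iff₀ (by norm_num : (0:ℝ) < 2)]
      have : i + 2 ≤ 2 ^ i * 2 := by
        have := @Nat.lt_two_pow_self (i + 1)
        rw [pow_succ] at this
        omega
      exact_mod_cast this
    exact h2i.trans (pow_le_pow_left₀ (by norm_num) hL1 i)
  calc ((L : ℝ) + 1) * (j : ℝ) ^ β₀ = ((L : ℝ) + 1) * (2 : ℝ) ^ β₀ * ((j : ℝ) / 2) ^ β₀ := by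
        rw [hsplit]; ring
    _ ≤ ((L : ℝ) + 1) * (2 : ℝ) ^ β₀ * ((j : ℝ) / 2) :=
        mul_le_mul_of_nonneg_left hhalf (by positivity)
    _ < (L : ℝ) ^ 2 * ((j : ℝ) / 2) := mul_lt_mul_of_pos_right hLβ (by linarith)
    _ ≤ (L : ℝ) ^ j := hpow

/-- **`GapHyp` from the printed (2.9) [III]** (third member, *"R_m ≤ (L+1)(n−m)^{β₀}R_n"* for `m < n`) with the
sizes `R_j = L^{s_j}` of (2.5), provided `(L+1)·2^{β₀} < L²`, `β₀ ≤ 1` (`β₀` *"can be chosen arbitrarily small"*,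
(2.6) [III]). [cite: Balaban1989LargeFieldI, p.179] -/
theorem gapHyp_of_third_member {L : ℕ} (hL : 2 ≤ L) {β₀ : ℝ} (hβ1 : β₀ ≤ 1)
    (hLβ : ((L : ℝ) + 1) * (2 : ℝ) ^ β₀ < (L : ℝ) ^ 2) {s : ℕ → ℕ} {k : ℕ}
    (h29 : ∀ m n, 1 ≤ m → m < n → n ≤ k →
      ((L ^ s m : ℕ) : ℝ) ≤ ((L : ℝ) + 1) * ((n : ℝ) - m) ^ β₀ * ((L ^ s n : ℕ) : ℝ)) :
    GapHyp s k := by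
  intro m n hm hmn hn hj
  have h := h29 m n hm hmn hn
  have hjlt := succ_mul_rpow_lt_pow hL hβ1 hLβ hj
  have hcast : ((n : ℝ) - m) = ((n - m : ℕ) : ℝ) := by push_cast [Nat.cast_sub hmn.le]; ring
  rw [hcast] at h
  have hLpos : (0 : ℝ) < ((L ^ s n : ℕ) : ℝ) := by positivity
  have hlt : ((L ^ s m : ℕ) : ℝ) < (L : ℝ) ^ (n - m) * ((L ^ s n : ℕ) : ℝ) :=
    lt_of_le_of_lt h (mul_lt_mul_of_pos_right hjlt hLpos)
  have hnat : L ^ s m < L ^ (n - m) * L ^ s n := by exact_mod_cast hlt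
  rw [← pow_add] at hnat
  have := (Nat.pow_lt_pow_iff_right (by omega : 1 < L)).1 hnat
  omega

/-! ## (b) Existence, under monotone unit steps -/

/-- EXISTENCE of a solution by the discrete intermediate-value argument: if the sizes grow toward the finer scales by
at most one factor `L` per step and never decrease (`s_j ∈ {s_{j+1}, s_{j+1}+1}` for `1 ≤ j < k`) and there are enough
scales (`s_1 + 1 ≤ k`), then `s_{k−N+1} = N − 1` has a solution `1 ≤ N ≤ k` (the quantity `s_{k−N+1} − (N−1)` starts
`≥ 0` at `N = 1`, ends `≤ 0` at `N = k`, and drops by at most one per step). [cite: Balaban1989LargeFieldI, p.179] -/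
theorem exists_sol {s : ℕ → ℕ} {k : ℕ} (hk : 1 ≤ k)
    (hmono : ∀ j, 1 ≤ j → j < k → s j = s (j + 1) ∨ s j = s (j + 1) + 1) (hend : s 1 + 1 ≤ k) :
    (sols s k).Nonempty := by
  -- the first `N ≤ k` at which `s (k − N + 1) + 1 ≤ N`, i.e. the deficit is `≤ 0`
  have hex : ∃ N, 1 ≤ N ∧ N ≤ k ∧ s (k - N + 1) + 1 ≤ N := ⟨k, hk, le_rfl, by
    rw [show k - k + 1 = 1 by omega]; exact hend⟩
  classical
  let N := Nat.find hex
  obtain ⟨hN1, hNk, hNle⟩ : 1 ≤ N ∧ N ≤ k ∧ s (k - N + 1) + 1 ≤ N := Nat.find_spec hex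
  refine ⟨N, mem_sols.2 ⟨⟨hN1, hNk⟩, ?_⟩⟩
  unfold Eq179
  by_cases hN : N = 1
  · -- at N = 1 the deficit is ≥ 0, hence = 0
    rw [hN] at hNle ⊢
    omega
  · -- minimality: at N − 1 the deficit is ≥ 1; one step changes `s` by at most one
    have hmin : ¬ (1 ≤ N - 1 ∧ N - 1 ≤ k ∧ s (k - (N - 1) + 1) + 1 ≤ N - 1) :=
      Nat.find_min hex (by omega : N - 1 < N)
    have hprev : ¬ (s (k - (N - 1) + 1) + 1 ≤ N - 1) := fun h => hmin ⟨by omega, by omega, h⟩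
    have hstep := hmono (k - N + 1) (by omega) (by omega)
    have e : k - (N - 1) + 1 = k - N + 1 + 1 := by omega
    rw [e] at hprev
    omega

/-! ## (c) The printed dichotomy -/

/-- **«Either there is exactly one such integer, or there are two»**: from (a) (gaps, i.e. (2.9) [III]) and (b)
(existence). [cite: Balaban1989LargeFieldI, p.179] -/
theorem claim179_of {s : ℕ → ℕ} {k : ℕ} (hg : GapHyp s k) (hne : (sols s k).Nonempty) : Claim179 s k := by
  unfold Claim179
  have h2 := card_sols_le_two hg
  have h1 := Finset.card_pos.2 hne
  omega

/-- … and then `N₀` exists (the minimum of the solution set) and every solution is `N₀` or `N₀ + 1`.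
[cite: Balaban1989LargeFieldI, p.179] -/
theorem exists_isN0 {s : ℕ → ℕ} {k : ℕ} (hg : GapHyp s k) (hne : (sols s k).Nonempty) :
    ∃ N₀, IsN0 s k N₀ ∧ ∀ N ∈ sols s k, N = N₀ ∨ N = N₀ + 1 := by
  refine ⟨(sols s k).min' hne, ⟨Finset.min'_mem _ hne, fun N hN => Finset.min'_le _ _ hN⟩, fun N hN => ?_⟩
  have h1 : (sols s k).min' hne ≤ N := Finset.min'_le _ _ hN
  have h2 := sol_sub_le_one hg (Finset.min'_mem _ hne) hN
  omega

/-- DICTIONARY to (2.5) [III]: a size obeying `B14.IsRj` is a power of `L`, so the exponent bookkeeping above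
applies to the printed `R_j`. [cite: Balaban1989LargeFieldI, p.179] -/
theorem exists_exp_of_isRj {L r : ℕ} {g : ℝ} {Rj : ℕ} (h : B14.IsRj L r g Rj) : ∃ s : ℕ, Rj = L ^ s := by
  obtain ⟨s, hs, -, -⟩ := h
  exact ⟨s, hs⟩

end Literature.MathematicalPhysics.QuantumFieldTheory.Balaban1983to89.B15Claim179
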